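import Literature.MathematicalPhysics.QuantumFieldTheory.Balaban1983to89.B8ExpMeanLogCrossTermUnitaryRec

/-!
# [B8] = [Balaban1985Averaging] (78)–(81), (167) — RECORD LAYER: **THE (78)-FAMILY OSCILLATION ROWS OF THE PRODUCT `a·u` UNDER A CELL** from the factors' rows and ✓p755344's
# sub-cell cross-term bound — the local-smallness input of the junction's GUARD RELEASE (FILE 40c `uavgZG_one_eq_uavgZ_one_under_of_small`)

Cell `pub-ymgap`, width seat `pub-ymgap-dag-n07-w3` g13 (junction side of the K0 road).  `--kind proof --supports stmt-QuantumFields-20541` (K0⁷; count-neutral; THEOREMS ONLY, 0 `def`).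
[3] = [Balaban1985Averaging]; [6] = [Balaban1985RegularSpaces]; [I] = [Balaban1987RG1].  CONSUMED BY NAME, nothing modified: this seat's ✓p755344
`B8ExpMeanLogCrossTermUnitaryRec.{norm_uavgZ_one_mul_sub_mul_le_at_sub, uavgZ_one_mul_mem_unitaryUnits_under}`, ✓p747787 `B8ExpMeanLogCrossTermGeomRec.uavgZ_one_mem_unitaryUnits_under`,
dag-n05-d's `B8Eq119TwistedAxialRec.{UnderZ, underZ_one_block, underZ_one_centre}`, `B8BlockConstantLiftStabilityRec.underZ_add`, `B7SectEFLinearisationRec.{blockSitesZ, mem_blockSitesZ}`.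

WHY.  The junction's row 9′ is read on the torus through the GUARDED average (`uavgZG L δ_N`, [I] (0.4)); FILE 40c releases the guard under a cell given LOCAL SMALLNESS of the (78) families
of the field `g = a·u` (`‖(R̄₀ⁱg(L·z))⁻¹·R̄₀ⁱg(L·z + r) − 1‖ < δ_N` for `i < j′`, `z` under the cell).  The cross-term files (✓p747787 ∕ ✓p755344 ∕ ✓p755807) bound `R̄₀^{j′}(a·u)(y)` itself but do
not export the product's family rows.  THIS FILE derives them from EXPORTED pieces only: the factors' rows `p_i`, `q_i`, the sub-cell cross-term bound `‖R̄₀ⁱ(a·u)(x₀) − R̄₀ⁱa(x₀)·R̄₀ⁱu(x₀)‖ ≤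
E_i := 1024·(s·θ^{j−i})²` at the centre `L·z` AND at the block point `x` (both under the cell at depth `j − i`), and unitarity of all six averages: with `P = R̄₀ⁱ(a·u)`, `A = R̄₀ⁱa`, `U = R̄₀ⁱu`,
`P₀⁻¹P_x − 1 = P₀⁻¹(P_x − A_xU_x) + P₀⁻¹(A₀U₀ − P₀)U₀⁻¹A₀⁻¹A_xU_x + U₀⁻¹(A₀⁻¹A_x − 1)U_x + (U₀⁻¹U_x − 1)`, so `‖P₀⁻¹P_x − 1‖ ≤ p_i + q_i + 2E_i`.  NO estimate of [3]∕[6]∕[I] beyond this algebra.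

WHAT IS PROVED (sorry-free; C⋆-algebra `𝔹`, nontrivial; odd `L`).
§1 `family_core` (private; the units algebra above, as a norm inequality), `h167_of_rows` (the factors' `1∕4`-rows, bookkeeping).
§2 ★★★ `osc_row_mul_under` — under ✓p755344's hypotheses (rows `p_i`, `q_i` with `p_i + q_i ≤ s·θ^{j−(i+1)}`, `θ ≤ 1∕2`, `s ≤ 1∕128`, `1024θs ≤ 1`, `a`, `u` unitary under the cell):
   for every `i < j`, `z` under `y` at depth `j − (i+1)`, `x` in the block of `z`: `‖(R̄₀ⁱ(a·u)(L·z))⁻¹·R̄₀ⁱ(a·u)(x) − 1‖ ≤ p_i + q_i + 2·1024·(s·θ^{j−i})²` — the product's (78)-family row,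
   the `hs` input of FILE 40c's guard release once `p_i + q_i + 2048·s² < δ_N`.
HONEST FRAMING: count-neutral helper; units algebra over landed estimates — nothing of [3]∕[6]∕[I] asserted or discharged; `NrmSymPhiOfRecord` ∕ `HThm4RecSym152PhiE(G)` ∕ `HThm4Rec*` UNDISCHARGED;
N05 ∕ N07 NOT discharged; K0⁷ ∕ K1⁹ NOT closed; counts unmoved (typed 28∕28 · discharged 8∕28); one finite 𝕋⁴ programme at fixed ε — R4 closes the conditional finite-𝕋⁴ rung `BalabanLadder.UV`
only; the YM mass gap (Clay) is NOT proved by any of this; nothing continuum ∕ ℝ⁴ ∕ OS.  No `def`, no `instance`, no `notation`, no `sorry`.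

[cite: Balaban1985Averaging, (78)–(81) p.30, (167) p.44; Balaban1985RegularSpaces, (1.29) p.81; Balaban1987RG1, (0.3)–(0.4) pp.252–253]
-/

set_option autoImplicit false

noncomputable section

open scoped BigOperators

namespace Literature.MathematicalPhysics.QuantumFieldTheory.Balaban1983to89.B8ExpMeanLogCrossTermFamilyRec

open B7Prop1Explicit hiding Site
open B7Prop1Explicit renaming Site → SiteZ
open B7SectEFLinearisationRec (blockSitesZ mem_blockSitesZ)
open B7SectCDGaugeAveragesRec (uavgZ)
open B8Eq119TwistedAxialRec (UnderZ underZ_zero_iff underZ_one_block underZ_one_centre)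
open B8BlockConstantLiftStabilityRec (underZ_add)
open B8ExpMeanLogCrossTermGeomRec (uavgZ_one_mem_unitaryUnits_under)
open B8ExpMeanLogCrossTermUnitaryRec (norm_uavgZ_one_mul_sub_mul_le_at_sub uavgZ_one_mul_mem_unitaryUnits_under)
open B7Prop2Explicit (unitaryUnits mem_unitaryUnits)
open BlockAveragingZd (offZ)

variable {d : ℕ} {𝔹 : Type*} [CStarAlgebra 𝔹] [Nontrivial 𝔹]

/-! ## §1  Units algebra -/

omit [Nontrivial 𝔹] in
/-- **THE FAMILY IDENTITY AS A NORM INEQUALITY**: for units `P₀ P_x A₀ A_x U₀ U_x` of `𝔹` with `‖P₀⁻¹‖, ‖A₀⁻¹‖, ‖U₀⁻¹‖, ‖A_x‖, ‖U_x‖ ≤ 1`, `‖P₀ − A₀U₀‖ ≤ E`, `‖P_x − A_xU_x‖ ≤ E`,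
`‖A₀⁻¹A_x − 1‖ ≤ p`, `‖U₀⁻¹U_x − 1‖ ≤ q`: `‖P₀⁻¹P_x − 1‖ ≤ p + q + 2E`. [folklore] -/
private theorem family_core (P0 Px A0 Ax U0 Ux : 𝔹ˣ) {E p q : ℝ} (hE : 0 ≤ E)
    (hP0 : ‖((P0⁻¹ : 𝔹ˣ) : 𝔹)‖ ≤ 1) (hA0 : ‖((A0⁻¹ : 𝔹ˣ) : 𝔹)‖ ≤ 1) (hU0 : ‖((U0⁻¹ : 𝔹ˣ) : 𝔹)‖ ≤ 1) (hAx : ‖(Ax : 𝔹)‖ ≤ 1) (hUx : ‖(Ux : 𝔹)‖ ≤ 1)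
    (he0 : ‖(P0 : 𝔹) - (A0 : 𝔹) * (U0 : 𝔹)‖ ≤ E) (hex : ‖(Px : 𝔹) - (Ax : 𝔹) * (Ux : 𝔹)‖ ≤ E)
    (hpa : ‖((A0⁻¹ : 𝔹ˣ) : 𝔹) * (Ax : 𝔹) - 1‖ ≤ p) (hqu : ‖((U0⁻¹ : 𝔹ˣ) : 𝔹) * (Ux : 𝔹) - 1‖ ≤ q) :
    ‖((P0⁻¹ : 𝔹ˣ) : 𝔹) * (Px : 𝔹) - 1‖ ≤ p + q + 2 * E := by
  set iP0 : 𝔹 := ((P0⁻¹ : 𝔹ˣ) : 𝔹) with hiP0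
  set iA0 : 𝔹 := ((A0⁻¹ : 𝔹ˣ) : 𝔹) with hiA0
  set iU0 : 𝔹 := ((U0⁻¹ : 𝔹ˣ) : 𝔹) with hiU0
  have e1 : iP0 * (P0 : 𝔹) = 1 := by rw [hiP0]; exact Units.inv_mul P0
  have e2 : (A0 : 𝔹) * iA0 = 1 := by rw [hiA0]; exact Units.mul_inv A0
  have e3 : (U0 : 𝔹) * iU0 = 1 := by rw [hiU0]; exact Units.mul_inv U0
  -- the identity
  have key : iP0 * (Px : 𝔹) - 1 =
      iP0 * ((Px : 𝔹) - (Ax : 𝔹) * (Ux : 𝔹)) + iP0 * ((A0 : 𝔹) * (U0 : 𝔹) - (P0 : 𝔹)) * (iU0 * iA0) * ((Ax : 𝔹) * (Ux : 𝔹)) +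
        (iU0 * (iA0 * (Ax : 𝔹) - 1) * (Ux : 𝔹) + (iU0 * (Ux : 𝔹) - 1)) := by
    have h1 : iP0 * ((A0 : 𝔹) * (U0 : 𝔹) - (P0 : 𝔹)) * (iU0 * iA0) * ((Ax : 𝔹) * (Ux : 𝔹)) =
        iP0 * ((A0 : 𝔹) * ((U0 : 𝔹) * iU0) * iA0) * ((Ax : 𝔹) * (Ux : 𝔹)) - (iP0 * (P0 : 𝔹)) * (iU0 * iA0) * ((Ax : 𝔹) * (Ux : 𝔹)) := by
      noncomm_ring
    rw [h1, e3, mul_one, e2, e1]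
    noncomm_ring
  rw [key]
  -- the four norms
  have n1 : ‖iP0 * ((Px : 𝔹) - (Ax : 𝔹) * (Ux : 𝔹))‖ ≤ E :=
    (norm_mul_le _ _).trans (by nlinarith [norm_nonneg ((Px : 𝔹) - (Ax : 𝔹) * (Ux : 𝔹)), norm_nonneg iP0])
  have n2 : ‖iP0 * ((A0 : 𝔹) * (U0 : 𝔹) - (P0 : 𝔹)) * (iU0 * iA0) * ((Ax : 𝔹) * (Ux : 𝔹))‖ ≤ E := by
    have ha : ‖(A0 : 𝔹) * (U0 : 𝔹) - (P0 : 𝔹)‖ ≤ E := by rw [← norm_neg, neg_sub]; exact he0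
    have hb : ‖iU0 * iA0‖ ≤ 1 := (norm_mul_le _ _).trans (by nlinarith [norm_nonneg iU0, norm_nonneg iA0])
    have hc : ‖(Ax : 𝔹) * (Ux : 𝔹)‖ ≤ 1 := (norm_mul_le _ _).trans (by nlinarith [norm_nonneg (Ax : 𝔹), norm_nonneg (Ux : 𝔹)])
    calc ‖iP0 * ((A0 : 𝔹) * (U0 : 𝔹) - (P0 : 𝔹)) * (iU0 * iA0) * ((Ax : 𝔹) * (Ux : 𝔹))‖
        ≤ ‖iP0‖ * ‖(A0 : 𝔹) * (U0 : 𝔹) - (P0 : 𝔹)‖ * ‖iU0 * iA0‖ * ‖(Ax : 𝔹) * (Ux : 𝔹)‖ := by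
          refine (norm_mul_le _ _).trans ?_
          refine mul_le_mul_of_nonneg_right ((norm_mul_le _ _).trans (mul_le_mul_of_nonneg_right (norm_mul_le _ _) (norm_nonneg _))) (norm_nonneg _)
      _ ≤ 1 * E * 1 * 1 := by
          have := norm_nonneg iP0
          have := norm_nonneg ((A0 : 𝔹) * (U0 : 𝔹) - (P0 : 𝔹))
          have := norm_nonneg (iU0 * iA0)
          have := norm_nonneg ((Ax : 𝔹) * (Ux : 𝔹))
          gcongr
      _ = E := by ring
  have n3 : ‖iU0 * (iA0 * (Ax : 𝔹) - 1) * (Ux : 𝔹)‖ ≤ p := by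
    calc ‖iU0 * (iA0 * (Ax : 𝔹) - 1) * (Ux : 𝔹)‖ ≤ ‖iU0‖ * ‖iA0 * (Ax : 𝔹) - 1‖ * ‖(Ux : 𝔹)‖ :=
          (norm_mul_le _ _).trans (mul_le_mul_of_nonneg_right (norm_mul_le _ _) (norm_nonneg _))
      _ ≤ 1 * p * 1 := by
          have := norm_nonneg iU0
          have := norm_nonneg (iA0 * (Ax : 𝔹) - 1)
          have := norm_nonneg (Ux : 𝔹)
          have hp0 : 0 ≤ p := le_trans (norm_nonneg _) hpa
          gcongr
      _ = p := by ring
  have n4 : ‖iU0 * (Ux : 𝔹) - 1‖ ≤ q := hqu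
  calc ‖iP0 * ((Px : 𝔹) - (Ax : 𝔹) * (Ux : 𝔹)) + iP0 * ((A0 : 𝔹) * (U0 : 𝔹) - (P0 : 𝔹)) * (iU0 * iA0) * ((Ax : 𝔹) * (Ux : 𝔹)) +
        (iU0 * (iA0 * (Ax : 𝔹) - 1) * (Ux : 𝔹) + (iU0 * (Ux : 𝔹) - 1))‖
      ≤ ‖iP0 * ((Px : 𝔹) - (Ax : 𝔹) * (Ux : 𝔹))‖ + ‖iP0 * ((A0 : 𝔹) * (U0 : 𝔹) - (P0 : 𝔹)) * (iU0 * iA0) * ((Ax : 𝔹) * (Ux : 𝔹))‖ +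
        (‖iU0 * (iA0 * (Ax : 𝔹) - 1) * (Ux : 𝔹)‖ + ‖iU0 * (Ux : 𝔹) - 1‖) := by
          refine (norm_add_le _ _).trans (add_le_add (norm_add_le _ _) (norm_add_le _ _))
    _ ≤ E + E + (p + q) := by gcongr
    _ = p + q + 2 * E := by ring

omit [Nontrivial 𝔹] in
/-- The factors' `1∕4`-rows in the `h167` shape (as in ✓p755344, bookkeeping). [cite: Balaban1985Averaging, (167) p.44 (bookkeeping)] -/
theorem h167_of_rows {L : ℕ} (a : SiteZ d → 𝔹ˣ) {j : ℕ} {y : SiteZ d} {p : ℕ → ℝ} (hp4 : ∀ i, i < j → p i ≤ 1 / 4)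
    (hp : ∀ i, i < j → ∀ z, UnderZ L (j - (i + 1)) y z → ∀ x ∈ blockSitesZ L z,
      ‖(((uavgZ L (1 : SiteZ d → Fin d → 𝔹ˣ) a i ((L : ℤ) • z))⁻¹ : 𝔹ˣ) : 𝔹) * ((uavgZ L (1 : SiteZ d → Fin d → 𝔹ˣ) a i x : 𝔹ˣ) : 𝔹) - 1‖ ≤ p i) :
    ∀ i, i < j → ∀ z, UnderZ L (j - (i + 1)) y z → ∀ r : Fin d → Fin L,
    ‖((((uavgZ L (1 : SiteZ d → Fin d → 𝔹ˣ) a i ((L : ℤ) • z))⁻¹ * uavgZ L (1 : SiteZ d → Fin d → 𝔹ˣ) a i ((L : ℤ) • z + offZ L r) : 𝔹ˣ)) : 𝔹) - 1‖ ≤ 1 / 4 := by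
  intro i hij z hz r
  rw [Units.val_mul]
  exact (hp i hij z hz _ (mem_blockSitesZ.2 ⟨r, rfl⟩)).trans (hp4 i hij)

/-! ## §2  The product's family rows under the cell -/

/-- ★★★ **THE (78)-FAMILY OSCILLATION ROWS OF `a·u` UNDER THE CELL** — under ✓p755344's hypotheses: for every `i < j`, `z` under `y` at depth `j − (i+1)` and `x` in the block of `z`,
`‖(R̄₀ⁱ(a·u)(L·z))⁻¹·R̄₀ⁱ(a·u)(x) − 1‖ ≤ p_i + q_i + 2·1024·(s·θ^{j−i})²` — the local-smallness input of FILE 40c's guard release for the junction's field `g = τ·h⁻¹·u₀` (with ✓p752835 the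
block-constant `h⁻¹` does not change `τ`'s rows). [cite: Balaban1985Averaging, (78)–(81) p.30, (167) p.44; Balaban1985RegularSpaces, (1.29) p.81; Balaban1987RG1, (0.3)–(0.4) pp.252–253] -/
theorem osc_row_mul_under {L : ℕ} (hL : Odd L) (a u : SiteZ d → 𝔹ˣ) (j : ℕ) (y : SiteZ d) (p q : ℕ → ℝ) {s θ : ℝ}
    (hp0 : ∀ i, 0 ≤ p i) (hq0 : ∀ i, 0 ≤ q i) (hθ0 : 0 ≤ θ) (hθ2 : θ ≤ 1 / 2) (hs0 : 0 ≤ s) (hs128 : s ≤ 1 / 128) (hθs : 1024 * θ * s ≤ 1)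
    (hpq : ∀ i, i < j → p i + q i ≤ s * θ ^ (j - (i + 1)))
    (ha : ∀ x, UnderZ L j y x → a x ∈ unitaryUnits 𝔹) (hu : ∀ x, UnderZ L j y x → u x ∈ unitaryUnits 𝔹)
    (hp : ∀ i, i < j → ∀ z, UnderZ L (j - (i + 1)) y z → ∀ x ∈ blockSitesZ L z,
      ‖(((uavgZ L (1 : SiteZ d → Fin d → 𝔹ˣ) a i ((L : ℤ) • z))⁻¹ : 𝔹ˣ) : 𝔹) * ((uavgZ L (1 : SiteZ d → Fin d → 𝔹ˣ) a i x : 𝔹ˣ) : 𝔹) - 1‖ ≤ p i)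
    (hq : ∀ i, i < j → ∀ z, UnderZ L (j - (i + 1)) y z → ∀ x ∈ blockSitesZ L z,
      ‖(((uavgZ L (1 : SiteZ d → Fin d → 𝔹ˣ) u i ((L : ℤ) • z))⁻¹ : 𝔹ˣ) : 𝔹) * ((uavgZ L (1 : SiteZ d → Fin d → 𝔹ˣ) u i x : 𝔹ˣ) : 𝔹) - 1‖ ≤ q i) :
    ∀ i, i < j → ∀ z, UnderZ L (j - (i + 1)) y z → ∀ x ∈ blockSitesZ L z,
      ‖(((uavgZ L (1 : SiteZ d → Fin d → 𝔹ˣ) (a * u) i ((L : ℤ) • z))⁻¹ : 𝔹ˣ) : 𝔹) *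
          ((uavgZ L (1 : SiteZ d → Fin d → 𝔹ˣ) (a * u) i x : 𝔹ˣ) : 𝔹) - 1‖ ≤ p i + q i + 2 * (1024 * (s * θ ^ (j - i)) ^ 2) := by
  intro i hij z hz x hx
  obtain ⟨s', hs'⟩ := id hL
  obtain ⟨r, rfl⟩ := mem_blockSitesZ.1 hx
  have hdepth : j - (i + 1) + 1 = j - i := by omega
  -- the centre and the block point are under the cell at depth `j − i`
  have hc : UnderZ L (j - i) y ((L : ℤ) • z) := by
    have h := underZ_add hL hz (underZ_one_centre L z); rwa [hdepth] at h
  have hxu : UnderZ L (j - i) y ((L : ℤ) • z + offZ L r) := by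
    have h := underZ_add hL hz (underZ_one_block hs' z r); rwa [hdepth] at h
  -- quarter rows and unitarity of all averages
  have h4 : ∀ l, l < j → p l ≤ 1 / 4 ∧ q l ≤ 1 / 4 := by
    intro l hl
    have h := hpq l hl
    have ht : θ ^ (j - (l + 1)) ≤ 1 := pow_le_one₀ hθ0 (hθ2.trans (by norm_num))
    have hs'' : s * θ ^ (j - (l + 1)) ≤ s := by nlinarith
    have := hp0 l; have := hq0 l
    constructor <;> linarith
  have hAu := uavgZ_one_mem_unitaryUnits_under hL a j y ha (h167_of_rows a (fun l hl => (h4 l hl).1) hp)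
  have hUu := uavgZ_one_mem_unitaryUnits_under hL u j y hu (h167_of_rows u (fun l hl => (h4 l hl).2) hq)
  have hPu := uavgZ_one_mul_mem_unitaryUnits_under hL a u j y p q hp0 hq0 hθ0 hθ2 hs0 hs128 hθs hpq ha hu hp hq
  -- the sub-cell cross-term bounds at the centre and at the block point
  have hwU : ∀ x₀, UnderZ L (j - i) y x₀ → ∀ l, l < i → ∀ z', UnderZ L (i - (l + 1)) x₀ z' →
      uavgZ L (1 : SiteZ d → Fin d → 𝔹ˣ) (a * u) l ((L : ℤ) • z') ∈ unitaryUnits 𝔹 := by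
    intro x₀ hx₀ l hl z' hz'
    refine hPu l (by omega) _ ?_
    have h := underZ_add hL (underZ_add hL hx₀ hz') (underZ_one_centre L z')
    rwa [show j - i + (i - (l + 1)) + 1 = j - l by omega] at h
  have he0 := norm_uavgZ_one_mul_sub_mul_le_at_sub hL a u j y p q hp0 hq0 hθ0 hθ2 hs0 hs128 hθs hpq ha hu hp hq hij.le hc (hwU _ hc)
  have hex := norm_uavgZ_one_mul_sub_mul_le_at_sub hL a u j y p q hp0 hq0 hθ0 hθ2 hs0 hs128 hθs hpq ha hu hp hq hij.le hxu (hwU _ hxu)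
  -- norms of unitary units are `1`
  have hn1 : ∀ {X : 𝔹ˣ}, X ∈ unitaryUnits 𝔹 → ‖(X : 𝔹)‖ ≤ 1 := fun hX =>
    (CStarRing.norm_of_mem_unitary (mem_unitaryUnits.1 hX)).le
  have hn1' : ∀ {X : 𝔹ˣ}, X ∈ unitaryUnits 𝔹 → ‖((X⁻¹ : 𝔹ˣ) : 𝔹)‖ ≤ 1 := fun hX =>
    (CStarRing.norm_of_mem_unitary (mem_unitaryUnits.1 ((unitaryUnits 𝔹).inv_mem hX))).le
  have hE : 0 ≤ 1024 * (s * θ ^ (j - i)) ^ 2 := by positivity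
  exact family_core _ _ _ _ _ _ hE (hn1' (hPu i hij.le _ hc)) (hn1' (hAu i hij.le _ hc)) (hn1' (hUu i hij.le _ hc)) (hn1 (hAu i hij.le _ hxu))
    (hn1 (hUu i hij.le _ hxu)) he0 hex (hp i hij z hz _ (mem_blockSitesZ.2 ⟨r, rfl⟩)) (hq i hij z hz _ (mem_blockSitesZ.2 ⟨r, rfl⟩))

end Literature.MathematicalPhysics.QuantumFieldTheory.Balaban1983to89.B8ExpMeanLogCrossTermFamilyRec

end
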